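import Summits.BirchSwinnertonDyer.BirchSwinnertonDyer.Theorems.CMKolyvaginAtInertTwoSilentSupplyOnSelmerRankOneOfBurungaleTian
import HarnessLib

/-! Scratch (bsd-line-cmk2-p1 g23): TURNKEY for the pen's edit «split crux 28663 `CMSilentHeegnerTwinSupplyAtInertTwo` (HL′) along
`Nat.card (W.selmerGroup 2) = 2`» (memo `TURNKEY-HLPRIME-ALGEBRAIC-g23.md` §4).  Kernel check that (i) HL′₀ (the `#Sel₂ = 2` half) closes BY NAME
modulo the two prints Burungale–Tian 2026 Thm 1.1 + modularity, via the landed p766325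
`KolyvaginLowerTwo.exists_silentHeegnerField_of_natCard_selmerGroup_eq_two`; (ii) the glue HL′₀ → HL′₁ → HL′ is `by_cases`.  Decl texts = the
rev-22 decl of 28663 with ONE clause inserted after `W.analyticRank = 1 →`.  Nothing is filed here; the edit is the pen's (D-0059/W-79).
BSD is not proved by any of this; HL′₁ is OPEN. -/

-- single-conjunct summit: `Summit.BirchSwinnertonDyer.BirchSwinnertonDyer.…` repeats the name by design
set_option linter.dupNamespace false
set_option autoImplicit false

noncomputable section

open scoped Classical

namespace Scratch.CMSilentSupplySelmerSplit

open WeierstrassCurve NumberField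
open Literature.NumberTheory.EllipticCurves
open Summit.BirchSwinnertonDyer.BirchSwinnertonDyer.Theses.CMKolyvaginAtInertTwo (CMSilentHeegnerTwinSupplyAtInertTwo)
open Summit.BirchSwinnertonDyer.BirchSwinnertonDyer.Theorems

/-- PROPOSED HL′₀ `CMSilentHeegnerTwinSupplyAtInertTwoSelmerRankOne` (text = 28663 + «Nat.card (W.selmerGroup 2) = 2 →» after `W.analyticRank = 1 →`). -/
def CMSilentHeegnerTwinSupplyAtInertTwoSelmerRankOne : Prop :=
  ∀ (W : WeierstrassCurve ℚ) [W.IsElliptic] [W.IsGloballyMinimal] [NeZero (W.conductorNorm ℤ)], W.HasCM → Literature.NumberTheory.EllipticCurves.Rank1Residual.CMInert W 2 → W.HasSurjectiveModNGaloisRep (2 : ℤ) → W.analyticRank = 1 → Nat.card (W.selmerGroup 2) = 2 → ∃ (K : Type) (_ : Field K) (_ : NumberField K), Literature.NumberTheory.EllipticCurves.IsImaginaryQuadratic K ∧ Odd (NumberField.discr K) ∧ NumberField.discr K ≠ -3 ∧ Literature.NumberTheory.EllipticCurves.SatisfiesHeegnerHypothesis (W.conductorNorm ℤ) K ∧ (∑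 q ∈ (NumberField.discr K).natAbs.primeFactors, ((if jacobiSym W.Δ.num q = -1 then 1 else 0) + (if jacobiSym W.Δ.num q = 1 ∧ Even (W.frobeniusTrace q) then 2 else 0)) ≤ 1) ∧ (W.quadraticTwist (NumberField.discr K : ℚ)).entireLFunction 1 ≠ 0

/-- PROPOSED HL′₁ `CMSilentHeegnerTwinSupplyAtInertTwoSelmerWide` (text = 28663 + «Nat.card (W.selmerGroup 2) ≠ 2 →»): the RESIDUAL crux. -/
def CMSilentHeegnerTwinSupplyAtInertTwoSelmerWide : Prop :=
  ∀ (W : WeierstrassCurve ℚ) [W.IsElliptic] [W.IsGloballyMinimal] [NeZero (W.conductorNorm ℤ)], W.HasCM → Literature.NumberTheory.EllipticCurves.Rank1Residual.CMInert W 2 → W.HasSurjectiveModNGaloisRep (2 : ℤ) → W.analyticRank = 1 → Nat.card (W.selmerGroup 2) ≠ 2 → ∃ (K : Type) (_ : Field K) (_ : NumberField K), Literature.NumberTheory.EllipticCurves.IsImaginaryQuadratic K ∧ Odd (NumberField.discr K) ∧ NumberField.discr K ≠ -3 ∧ Literature.NumberTheory.EllipticCurves.SatisfiesHeegnerHypothesis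 (W.conductorNorm ℤ) K ∧ (∑ q ∈ (NumberField.discr K).natAbs.primeFactors, ((if jacobiSym W.Δ.num q = -1 then 1 else 0) + (if jacobiSym W.Δ.num q = 1 ∧ Even (W.frobeniusTrace q) then 2 else 0)) ≤ 1) ∧ (W.quadraticTwist (NumberField.discr K : ℚ)).entireLFunction 1 ≠ 0

/-- PROPOSED derivation item `CMSilentHeegnerTwinSupplyAtInertTwoSelmerRankOneOfFacts`: (Burungale–Tian 2026 Thm 1.1 ∧ modularity) → HL′₀. -/
def CMSilentHeegnerTwinSupplyAtInertTwoSelmerRankOneOfFacts : Prop :=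
  (Literature.NumberTheory.EllipticCurves.burungaleTian_analyticRank_eq_zero_of_selmerCorank_eq_zero_of_hasCM ∧ WeierstrassCurve.hasEntireLFunction_rat) → CMSilentHeegnerTwinSupplyAtInertTwoSelmerRankOne

/-- PROPOSED glue: HL′₀ → HL′₁ → HL′ (28663 verbatim). -/
def CMSilentHeegnerTwinSupplyOfSelmerSplit : Prop :=
  CMSilentHeegnerTwinSupplyAtInertTwoSelmerRankOne → CMSilentHeegnerTwinSupplyAtInertTwoSelmerWide → CMSilentHeegnerTwinSupplyAtInertTwo

/-- THE CLOSER of the derivation item (3 lines over p766325). -/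
theorem cmSilentHeegnerTwinSupplyAtInertTwoSelmerRankOneOfFacts_proof : CMSilentHeegnerTwinSupplyAtInertTwoSelmerRankOneOfFacts := by
  rintro ⟨hBT, hmod⟩ W _ _ _ hCM hin hρ _ hSel
  exact KolyvaginLowerTwo.exists_silentHeegnerField_of_natCard_selmerGroup_eq_two hBT hmod W hCM hin hρ hSel

/-- THE GLUE CLOSER (`by_cases` on `Nat.card (W.selmerGroup 2) = 2`). -/
theorem cmSilentHeegnerTwinSupplyOfSelmerSplit_proof : CMSilentHeegnerTwinSupplyOfSelmerSplit := by
  intro h0 h1 W _ _ _ hCM hin hρ hr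
  by_cases h : Nat.card (W.selmerGroup 2) = 2
  · exact h0 W hCM hin hρ hr h
  · exact h1 W hCM hin hρ hr h

/-- Sanity: the split is conservative — HL′ implies both halves. -/
theorem selmerRankOne_of_all (h : CMSilentHeegnerTwinSupplyAtInertTwo) : CMSilentHeegnerTwinSupplyAtInertTwoSelmerRankOne :=
  fun W _ _ _ hCM hin hρ hr _ ↦ h W hCM hin hρ hr

end Scratch.CMSilentSupplySelmerSplit

end
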